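import Summits.AnomalousDissipation.AnomalousDissipation.Theorems.SoloBlindDissipationFloorLH
import Summits.AnomalousDissipation.AnomalousDissipation.Theorems.SoloBlindEnergyFloorKolmogorov

/-!
# Solo (blind) — the linear-in-`ν` dissipation floor for the Kolmogorov force

Instance of `SoloBlindDissipationFloorLH` for `f = cos(2πx₃)e₁` (`kolForce`) with the multiplier
`Ψ = f`: `Γ₀ = ∫|f|² = ½`, `|∇f|_F = 2π|sin 2πx₃| ≤ 2π`, so along every vanishing-viscosity family
of global Leray–Hopf solutions of `NS_{νⱼ}(f)` with `meanEnergy ≤ E` (arbitrary data and momenta),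
eventually `meanDissipation νⱼ uⱼ ≥ νⱼ/(128π²E)`. The drifted exact states of
`SoloBlindDriftScreening` have energy `≤ c² + 1/(8π²c²)` and dissipation `≤ ν/(2c²)`: the order
`ν/E` is attained, so for this force the infimum of the mean dissipation over bounded-energy
Leray–Hopf families is `Θ(ν/E)` — two-sided, kernel-checked. [cite: DoeringFoias2002, §3]
-/

open MeasureTheory Filter Topology Set UnitAddTorus
open scoped ENNReal NNReal InnerProductSpace

noncomputable section

namespace Summit.AnomalousDissipation.AnomalousDissipation.Theorems

open Literature.Analysis.FunctionSpaces Literature.Analysis.FunctionSpaces.Torus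
open Literature.Analysis.FluidPDE

/-- Frobenius bound `|∇f(y)|_F ≤ 2π` for the Kolmogorov force (`∂₁f = ∂₂f = 0`, `∂₃f = -2π g`,
`|g| ≤ 1`). [folklore] -/
theorem frobenius_kolForce_le (y : UnitAddTorus (Fin 3)) :
    Real.sqrt (∑ i, ‖Torus.partialDeriv i kolForce y‖ ^ 2) ≤ 2 * Real.pi := by
  have hsum : ∑ i, ‖Torus.partialDeriv i kolForce y‖ ^ 2 = (2 * Real.pi) ^ 2 * ‖kolSin y‖ ^ 2 := by
    rw [Fin.sum_univ_three]
    rw [partialDeriv_zero_kolForce, partialDeriv_one_kolForce,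
      partialDeriv_two_kolForce, norm_zero, norm_smul, Real.norm_eq_abs, abs_neg,
      abs_of_pos (by positivity : (0 : ℝ) < 2 * Real.pi)]
    ring
  rw [hsum]
  have h1 : (2 * Real.pi) ^ 2 * ‖kolSin y‖ ^ 2 ≤ (2 * Real.pi) ^ 2 := by
    have hg := norm_kolSin_le y
    have : ‖kolSin y‖ ^ 2 ≤ 1 := by nlinarith [norm_nonneg (kolSin y)]
    nlinarith [sq_nonneg (2 * Real.pi)]
  calc Real.sqrt ((2 * Real.pi) ^ 2 * ‖kolSin y‖ ^ 2) ≤ Real.sqrt ((2 * Real.pi) ^ 2) :=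
        Real.sqrt_le_sqrt h1
    _ = 2 * Real.pi := Real.sqrt_sq (by positivity)

/-- **Kolmogorov force: the mean dissipation of every bounded-energy vanishing-viscosity
Leray–Hopf family is eventually at least `νⱼ/(128π²E)`** (arbitrary data and momenta; `E` any
bound on the mean energies — necessarily `E ≥ 1/(2π)` by `kolmogorov_energyBound_ge`).
[cite: DoeringFoias2002, §3] -/
theorem kolmogorov_meanDissipation_ge_eventually {ν : ℕ → ℝ}
    {u₀ : ℕ → UnitAddTorus (Fin 3) → EuclideanSpace ℝ (Fin 3)}
    {u : ℕ → ℝ → UnitAddTorus (Fin 3) → EuclideanSpace ℝ (Fin 3)} {E : ℝ}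
    (hν : ∀ j, 0 < ν j) (hν₀ : Tendsto ν atTop (𝓝 0))
    (hu : ∀ j, Torus.IsGlobalLerayHopf (ν j) (fun _ => kolForce) (u₀ j) (u j))
    (hE : ∀ j, meanEnergy (u j) ≤ E) :
    ∀ᶠ j in atTop, ν j / (128 * Real.pi ^ 2 * E) ≤ meanDissipation (ν j) (u j) := by
  have hEpos : 0 < E :=
    lt_of_lt_of_le (by positivity) (kolmogorov_energyBound_ge hν hν₀ hu hE)
  have hΓ : 0 < ∫ x, ⟪kolForce x, kolForce x⟫_ℝ := by
    rw [integral_inner_kolForce_self]; norm_num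
  have h := meanDissipation_ge_linear_eventually hν hν₀ hu isSmooth_kolForce hasZeroMean_kolForce
    isSmooth_kolForce isDivFree_kolForce frobenius_kolForce_le (by positivity) hΓ hE hEpos
  filter_upwards [h] with j hj
  rw [integral_inner_kolForce_self] at hj
  have hid : ν j * ((1 / 2) ^ 2 / (8 * (2 * Real.pi) ^ 2 * E)) = ν j / (128 * Real.pi ^ 2 * E) := by
    field_simp
    ring
  rw [hid] at hj
  exact hj

/-- The same floor on the data of `Literature.Turb.ZerothLaw`: a would-be Kolmogorov witness of
the zeroth law with energy bound `E` and dissipation floor `ε` must in any case have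
`meanDissipation ≥ νⱼ/(128π²E)` eventually — the a-priori information is of order `νⱼ`, the
floor `ε` asked for is of order one. [folklore] -/
theorem kolmogorov_witness_meanDissipation_ge_eventually {ν : ℕ → ℝ}
    {u : ℕ → ℝ → UnitAddTorus (Fin 3) → EuclideanSpace ℝ (Fin 3)} {E : ℝ}
    (hν : ∀ j, 0 < ν j) (hν₀ : Tendsto ν atTop (𝓝 0))
    (hu : ∀ j, ∃ u₀, Torus.IsGlobalLerayHopf (ν j) (fun _ => kolForce) u₀ (u j))
    (hE : ∀ j, meanEnergy (u j) ≤ E) :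
    ∀ᶠ j in atTop, ν j / (128 * Real.pi ^ 2 * E) ≤ meanDissipation (ν j) (u j) := by
  choose u₀ hu₀ using hu
  exact kolmogorov_meanDissipation_ge_eventually hν hν₀ hu₀ hE

end Summit.AnomalousDissipation.AnomalousDissipation.Theorems
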